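import Literature.Probability.RandomPlanarGeometry.HexSAWHexagonSurgery
import HarnessLib

/-!
# Hexagon surgery on fixed-endpoint walks of the honeycomb lattice: the transfer counts (P1-E), (P2-E)

Topic `Literature/Probability/RandomPlanarGeometry` (lane «pcv-sawmu», door «HEX-ENDPOINT-RATIO-2»; continues
`HexSAWHexagonSurgery.lean` — THE WALK MODEL: `S_N(ℍ) = HV.sawFin hvOrigin N`, the insertion slots `hexSlots`, the deletion
sites `hexSharp`, the surgeries `hexIns`/`hexDel`, their laws and the slot-pair/site-pair bijection
`sum_hexSlotPairs_eq_sum_hexSharpPairs` — and `HexSAWKestenTransfer.lean` / `HexSAWDoubleTransfer.lean` — the counts (P1-ℍ),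
(P2-ℍ) over ALL walks).

Source of the method: N. Madras, G. Slade, *The Self-Avoiding Walk* (1993), §7.3, proof of Theorem 7.3.2, pp. 244–247,
eqs. (7.3.5)–(7.3.7) (counting the allowed `U → V` changes in two ways), and Theorem 7.3.2 (c) / Theorem 7.3.4 (b), (c)
p. 248: on `ℤ^d` the SAME surgery argument applies verbatim to the walks with a FIXED ENDPOINT `x` ("(c) (7.3.4) holds
for `φ_N = c_{N+2}(0,x)/c_N(0,x)`", since the cube surgery does not move the endpoints) and yields Kesten's two-step ratio
limit theorem for `c_N(0,x)` and for polygons. Here: the honeycomb version. The hexagon surgeries of `HexSAWHexagonSurgery`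
rewrite a walk strictly inside the window `ω_m … ω_{m+2}` (insertion) / `ω_m … ω_{m+4}` (deletion) and keep every vertex
from `ω_{m+2}` / `ω_{m+4}` on, with an index shift of `±2`; in particular THE LAST VERTEX IS KEPT
(`getD_last_hexIns`, `getD_last_hexDel`). Hence the family `E_N(x) := {ω ∈ S_N(ℍ) : ω_N = x}` of `N`-step self-avoiding
walks from the origin to `x` is closed under both surgeries with the FULL slot and site sets, the four bookkeeping lemmas of
the walk file apply unchanged, and the transfer counts (P1), (P2) of Madras–Slade (7.3.6)/(7.3.7) hold over `E_N(x)` with the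
same constants `24 / 324 / (J+24)(J+48)` as for all walks. (For `x` a neighbour of the origin, `E_N(x)` is the set of rooted,
oriented `(N+1)`-gons through the edge `{0, x}`.)

Status in print: `ℤ^d` — Madras–Slade Theorem 7.3.2 (c) (stated, "the same argument"); `ℍ` — nothing printed; this is the
honeycomb port, first written and kernel-checked here (consolidation; no new combinatorial idea beyond «surgery keeps
endpoints»).

## Contents (namespace `Literature.Probability.RandomPlanarGeometry.SAW.HV`; all PROVED, axioms standard)

* `endFin x N` (the family `E_N(x)`), `mem_endFin`, `endFin_subset`, `card_endFin_le`;
* `getD_last_hexIns`, `getD_last_hexDel`, **`hexIns_mem_endFin`**, **`hexDel_mem_endFin`** (closure);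
* `endSlotPairs`, `endSharpPairs`, `sum_endSlotPairs`, `sum_endSharpPairs`,
  **`sum_endSlotPairs_eq_sum_endSharpPairs`** (the restricted pair bijection);
* **`endKesten_P1'`** — `#{ω' ∈ E_{N+2}(x) : J(ω') ≥ 1} ≤ Σ_{ω ∈ E_N(x)} I(ω)/max(J(ω) − 24, 1)`;
* `sum_card_hexSlots_div_le_card_endFin` (level `N+2`), **`endKesten_P2`** —
  `Σ_{ω ∈ E_N(x)} I(ω)·max(0, I(ω) − 324)/((J(ω)+24)(J(ω)+48)) ≤ #E_{N+4}(x)`.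
-/

noncomputable section

open Finset
open Literature.Probability.LatticeModels Literature.Probability.Percolation SimpleGraph

namespace Literature.Probability.RandomPlanarGeometry.SAW.HV

/-! ### The fixed-endpoint family -/

section Family

variable {N : ℕ} {x : HV} {ω : List HV} {m : ℕ} {a y z v : HV}

/-- **The fixed-endpoint family `E_N(x)`**: `N`-step self-avoiding walks of `ℍ` from the origin whose last vertex is `x`
(`#E_N(x) = c_N(0,x;ℍ)`; for `x ~ 0` the rooted oriented `(N+1)`-gons through the edge `{0,x}`).
[cite: MadrasSlade1993, §1.1 (c_N(0,x)) and Theorem 7.3.2 (c)] -/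
def endFin (x : HV) (N : ℕ) : Finset (List HV) := (sawFin hvOrigin N).filter fun ω => ω.getD N hvOrigin = x

/-- Membership in `E_N(x)`. [cite: MadrasSlade1993, §1.1] -/
theorem mem_endFin : ω ∈ endFin x N ↔ ω ∈ sawFin hvOrigin N ∧ ω.getD N hvOrigin = x := mem_filter

/-- `E_N(x) ⊆ S_N(ℍ)`. [cite: MadrasSlade1993, §1.1] -/
theorem endFin_subset (x : HV) (N : ℕ) : endFin x N ⊆ sawFin hvOrigin N := filter_subset _ _

/-- `c_N(0,x;ℍ) ≤ c_N(ℍ)`. [cite: MadrasSlade1993, §1.1] -/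
theorem card_endFin_le (x : HV) (N : ℕ) : #(endFin x N) ≤ hexSawCount N := by
  rw [hexSawCount_eq_card]; exact card_le_card (endFin_subset x N)

/-- Hexagon insertion keeps the last vertex: `(hexIns s ω)_{N+2} = ω_N`.
[cite: MadrasSlade1993, §7.3 (proof of Theorem 7.3.2); Theorem 7.3.2 (c)] -/
theorem getD_last_hexIns (hω : ω ∈ sawFin hvOrigin N) (hs : (m, a, y, z) ∈ hexSlots ω) :
    (hexIns m a y z ω).getD (N + 2) hvOrigin = ω.getD N hvOrigin := by
  obtain ⟨hm, -⟩ := mem_hexSlots.1 hs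
  have hl := length_of_mem_sawFin hω
  rw [getD_hexIns_of_ge (by omega) (by omega), show N + 2 - 2 = N from rfl]

/-- Hexagon deletion keeps the last vertex: `(hexDel s ω)_N = ω_{N+2}`.
[cite: MadrasSlade1993, §7.3 (proof of Theorem 7.3.2); Theorem 7.3.2 (c)] -/
theorem getD_last_hexDel (hω : ω ∈ sawFin hvOrigin (N + 2)) (hp : (m, v) ∈ hexSharp ω) :
    (hexDel m v ω).getD N hvOrigin = ω.getD (N + 2) hvOrigin := by
  obtain ⟨hml, -⟩ := mem_hexSharp.1 hp
  have hl := length_of_mem_sawFin hω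
  rw [getD_hexDel_of_ge (by omega) (by omega)]

/-- **Closure of `E_N(x)` under hexagon insertion.** [cite: MadrasSlade1993, Theorem 7.3.2 (c) ("the same argument")] -/
theorem hexIns_mem_endFin (hω : ω ∈ endFin x N) (hs : (m, a, y, z) ∈ hexSlots ω) :
    hexIns m a y z ω ∈ endFin x (N + 2) := by
  obtain ⟨hω', hx⟩ := mem_endFin.1 hω
  exact mem_endFin.2 ⟨hexIns_mem_sawFin hω' hs, by rw [getD_last_hexIns hω' hs, hx]⟩

/-- **Closure of `E_N(x)` under hexagon deletion.** [cite: MadrasSlade1993, Theorem 7.3.2 (c) ("the same argument")] -/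
theorem hexDel_mem_endFin (hω : ω ∈ endFin x (N + 2)) (hp : (m, v) ∈ hexSharp ω) :
    hexDel m v ω ∈ endFin x N := by
  obtain ⟨hω', hx⟩ := mem_endFin.1 hω
  exact mem_endFin.2 ⟨hexDel_mem_sawFin hω' hp, by rw [getD_last_hexDel hω' hp, hx]⟩

end Family

/-! ### Slot pairs and site pairs over the fixed-endpoint family -/

section Pairs

variable (x : HV)

/-- The slot pairs `(ω, (m, a, y, z))`, `ω ∈ E_N(x)`. [cite: MadrasSlade1993, §7.3 (proof of Theorem 7.3.2), (7.3.5)] -/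
def endSlotPairs (N : ℕ) : Finset (Σ _ : List HV, ℕ × HV × HV × HV) := (endFin x N).sigma fun ω => hexSlots ω

/-- The deletion-site pairs `(ω, (m, v))`, `ω ∈ E_N(x)`. [cite: MadrasSlade1993, §7.3 (proof of Theorem 7.3.2), (7.3.5)] -/
def endSharpPairs (N : ℕ) : Finset (Σ _ : List HV, ℕ × HV) := (endFin x N).sigma fun ω => hexSharp ω

/-- Summing over slot pairs is summing `I(ω) · F(ω)` over `E_N(x)`. [cite: MadrasSlade1993, §7.3 (proof of Theorem 7.3.2)] -/
theorem sum_endSlotPairs (N : ℕ) (F : List HV → ℝ) :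
    ∑ p ∈ endSlotPairs x N, F p.1 = ∑ ω ∈ endFin x N, (#(hexSlots ω) : ℝ) * F ω := by
  rw [endSlotPairs, Finset.sum_sigma]
  refine sum_congr rfl fun ω _ => ?_
  change ∑ s ∈ hexSlots ω, F ω = _
  rw [sum_const, nsmul_eq_mul]

/-- Summing over deletion-site pairs is summing `J(ω) · F(ω)` over `E_N(x)`.
[cite: MadrasSlade1993, §7.3 (proof of Theorem 7.3.2)] -/
theorem sum_endSharpPairs (N : ℕ) (F : List HV → ℝ) :
    ∑ q ∈ endSharpPairs x N, F q.1 = ∑ ω ∈ endFin x N, (#(hexSharp ω) : ℝ) * F ω := by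
  rw [endSharpPairs, Finset.sum_sigma]
  refine sum_congr rfl fun ω _ => ?_
  change ∑ s ∈ hexSharp ω, F ω = _
  rw [sum_const, nsmul_eq_mul]

/-- **The restricted pair bijection**: `(ω, (m, a, y, z)) ↦ (hexIns m a y z ω, (m, ω_{m+1}))` maps the slot pairs of `E_N(x)`
bijectively onto the deletion-site pairs of `E_{N+2}(x)` (the bijection of `sum_hexSlotPairs_eq_sum_hexSharpPairs` preserves the
last vertex in both directions). [cite: MadrasSlade1993, §7.3 (proof of Theorem 7.3.2), (7.3.5)–(7.3.6); Theorem 7.3.2 (c)] -/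
theorem sum_endSlotPairs_eq_sum_endSharpPairs (N : ℕ) (F : (Σ _ : List HV, ℕ × HV × HV × HV) → ℝ)
    (G : (Σ _ : List HV, ℕ × HV) → ℝ)
    (h : ∀ p ∈ endSlotPairs x N,
      F p = G ⟨hexIns p.2.1 p.2.2.1 p.2.2.2.1 p.2.2.2.2 p.1, (p.2.1, p.1.getD (p.2.1 + 1) hvOrigin)⟩) :
    ∑ p ∈ endSlotPairs x N, F p = ∑ q ∈ endSharpPairs x (N + 2), G q := by
  refine Finset.sum_nbij' (fun p => ⟨hexIns p.2.1 p.2.2.1 p.2.2.2.1 p.2.2.2.2 p.1, (p.2.1, p.1.getD (p.2.1 + 1) hvOrigin)⟩)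
    (fun q => ⟨hexDel q.2.1 q.2.2 q.1,
      (q.2.1, q.1.getD (q.2.1 + 1) hvOrigin, q.1.getD (q.2.1 + 2) hvOrigin, q.1.getD (q.2.1 + 3) hvOrigin)⟩)
    ?_ ?_ ?_ ?_ h
  · rintro ⟨ω, m, a, y, z⟩ hp
    rw [endSlotPairs, Finset.mem_sigma] at hp
    rw [endSharpPairs, Finset.mem_sigma]
    exact ⟨hexIns_mem_endFin hp.1 hp.2, mem_hexSharp_hexIns (endFin_subset x N hp.1) hp.2⟩
  · rintro ⟨ω, m, v⟩ hq
    rw [endSharpPairs, Finset.mem_sigma] at hq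
    rw [endSlotPairs, Finset.mem_sigma]
    exact ⟨hexDel_mem_endFin hq.1 hq.2, mem_hexSlots_hexDel (endFin_subset x (N + 2) hq.1) hq.2⟩
  · rintro ⟨ω, m, a, y, z⟩ hp
    rw [endSlotPairs, Finset.mem_sigma] at hp
    dsimp only at hp
    obtain ⟨hm, -⟩ := mem_hexSlots.1 hp.2
    dsimp only
    rw [hexDel_hexIns (by omega), getD_hexIns_one (by omega), getD_hexIns_two (by omega),
      getD_hexIns_three (by omega)]
  · rintro ⟨ω, m, v⟩ hq
    rw [endSharpPairs, Finset.mem_sigma] at hq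
    dsimp only at hq
    obtain ⟨hml, -⟩ := mem_hexSharp.1 hq.2
    dsimp only
    rw [hexIns_hexDel (by omega), getD_hexDel_one (by omega)]

end Pairs

/-! ### (P1-E) The first transfer count over `E_N(x)` -/

section TransferP1E

variable (x : HV)

/-- **(P1-E), the first counting over the fixed-endpoint family** (Madras–Slade (7.3.6) restricted to `E_N(x)`, inexact
bookkeeping `c₁ = 24`): `#{ω' ∈ E_{N+2}(x) : J(ω') ≥ 1} ≤ Σ_{ω ∈ E_N(x)} I(ω)/max(J(ω) − 24, 1)`.
[cite: MadrasSlade1993, Theorem 7.3.2 (proof), (7.3.6); Theorem 7.3.2 (c)] -/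
theorem endKesten_P1' (N : ℕ) :
    (#((endFin x (N + 2)).filter fun ω' => 1 ≤ #(hexSharp ω')) : ℝ) ≤
      ∑ ω ∈ endFin x N, (#(hexSlots ω) : ℝ) / max ((#(hexSharp ω) : ℝ) - 24) 1 := by
  have hJ : (#((endFin x (N + 2)).filter fun ω' => 1 ≤ #(hexSharp ω')) : ℝ) =
      ∑ ω ∈ endFin x (N + 2), (#(hexSharp ω) : ℝ) * (1 / (#(hexSharp ω) : ℝ)) := by
    rw [card_eq_sum_ones, Nat.cast_sum, sum_filter]
    refine sum_congr rfl fun ω _ => ?_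
    by_cases h : 1 ≤ #(hexSharp ω)
    · rw [if_pos h, Nat.cast_one, mul_one_div_cancel]
      exact_mod_cast (show #(hexSharp ω) ≠ 0 by omega)
    · rw [if_neg h, show #(hexSharp ω) = 0 by omega]
      simp
  rw [hJ, ← sum_endSharpPairs x (N + 2) (fun ω => 1 / (#(hexSharp ω) : ℝ)),
    ← sum_endSlotPairs_eq_sum_endSharpPairs x N
      (fun p => 1 / (#(hexSharp (hexIns p.2.1 p.2.2.1 p.2.2.2.1 p.2.2.2.2 p.1)) : ℝ))
      (fun q => 1 / (#(hexSharp q.1) : ℝ)) (fun p _ => rfl)]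
  have hR : ∑ ω ∈ endFin x N, (#(hexSlots ω) : ℝ) / max ((#(hexSharp ω) : ℝ) - 24) 1 =
      ∑ p ∈ endSlotPairs x N, 1 / max ((#(hexSharp p.1) : ℝ) - 24) 1 := by
    rw [sum_endSlotPairs x N (fun ω => 1 / max ((#(hexSharp ω) : ℝ) - 24) 1)]
    refine sum_congr rfl fun ω _ => ?_
    rw [mul_one_div]
  rw [hR]
  refine sum_le_sum fun p hp => ?_
  obtain ⟨ω, m, a, y, z⟩ := p
  rw [endSlotPairs, mem_sigma] at hp
  dsimp only at hp ⊢
  obtain ⟨hω, hs⟩ := hp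
  have hω' := endFin_subset x N hω
  have h1 : (1 : ℝ) ≤ #(hexSharp (hexIns m a y z ω)) := by exact_mod_cast one_le_card_hexSharp_hexIns hω' hs
  have h2 : (#(hexSharp ω) : ℝ) - 24 ≤ #(hexSharp (hexIns m a y z ω)) := by
    have := card_hexSharp_le_hexIns hω' hs
    have h' : (#(hexSharp ω) : ℝ) ≤ #(hexSharp (hexIns m a y z ω)) + 24 := by exact_mod_cast this
    linarith
  exact one_div_le_one_div_of_le (lt_of_lt_of_le one_pos (le_max_right _ _)) (max_le h2 h1)

end TransferP1E

/-! ### (P2-E) The double transfer over `E_N(x)` -/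

section TransferP2E

variable (x : HV)

/-- **Level `N+2` of the double transfer over the fixed-endpoint family**: `Σ_{ω' ∈ E_{N+2}(x)} I(ω')/(J(ω')+24) ≤ #E_{N+4}(x)`.
[cite: MadrasSlade1993, Theorem 7.3.2 (proof), eq. (7.3.7); Theorem 7.3.2 (c)] -/
theorem sum_card_hexSlots_div_le_card_endFin (N : ℕ) :
    ∑ ω ∈ endFin x (N + 2), (#(hexSlots ω) : ℝ) / ((#(hexSharp ω) : ℝ) + 24) ≤ (#(endFin x (N + 4)) : ℝ) := by
  classical
  have e1 : ∑ ω ∈ endFin x (N + 2), (#(hexSlots ω) : ℝ) / ((#(hexSharp ω) : ℝ) + 24) =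
      ∑ p ∈ endSlotPairs x (N + 2), 1 / ((#(hexSharp p.1) : ℝ) + 24) := by
    rw [sum_endSlotPairs x (N + 2) (fun ω => 1 / ((#(hexSharp ω) : ℝ) + 24))]
    exact sum_congr rfl fun ω _ => by rw [mul_one_div]
  have e2 : ∑ p ∈ endSlotPairs x (N + 2), 1 / ((#(hexSharp p.1) : ℝ) + 24) ≤
      ∑ p ∈ endSlotPairs x (N + 2), 1 / (#(hexSharp (hexIns p.2.1 p.2.2.1 p.2.2.2.1 p.2.2.2.2 p.1)) : ℝ) := by
    refine sum_le_sum fun p hp => ?_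
    rw [endSlotPairs, Finset.mem_sigma] at hp
    obtain ⟨hω, hs⟩ := hp
    have hω' := endFin_subset x (N + 2) hω
    have hs' : (p.2.1, p.2.2.1, p.2.2.2.1, p.2.2.2.2) ∈ hexSlots p.1 := hs
    have hJ1 := one_le_card_hexSharp_hexIns hω' hs'
    have hJ3 := card_hexSharp_hexIns_le hω' hs'
    have hpos : (0 : ℝ) < #(hexSharp (hexIns p.2.1 p.2.2.1 p.2.2.2.1 p.2.2.2.2 p.1)) := by exact_mod_cast hJ1
    apply one_div_le_one_div_of_le hpos
    exact_mod_cast hJ3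
  have e3 : ∑ p ∈ endSlotPairs x (N + 2), 1 / (#(hexSharp (hexIns p.2.1 p.2.2.1 p.2.2.2.1 p.2.2.2.2 p.1)) : ℝ) =
      ∑ q ∈ endSharpPairs x (N + 2 + 2), 1 / (#(hexSharp q.1) : ℝ) :=
    sum_endSlotPairs_eq_sum_endSharpPairs x (N + 2) _ (fun q => 1 / (#(hexSharp q.1) : ℝ)) fun p _ => rfl
  have e4 : ∑ q ∈ endSharpPairs x (N + 2 + 2), 1 / (#(hexSharp q.1) : ℝ) ≤ (#(endFin x (N + 4)) : ℝ) := by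
    rw [sum_endSharpPairs x (N + 2 + 2) (fun ω => 1 / (#(hexSharp ω) : ℝ)), show N + 4 = N + 2 + 2 by ring,
      Finset.card_eq_sum_ones, Nat.cast_sum]
    refine sum_le_sum fun ω _ => ?_
    by_cases h : #(hexSharp ω) = 0
    · rw [h]; simp
    · rw [mul_one_div_cancel (by exact_mod_cast h)]; simp
  rw [e1]
  exact e2.trans (e3.le.trans e4)

/-- **(P2-E), the double transfer over the fixed-endpoint family** (Madras–Slade (7.3.7) restricted to `E_N(x)`):
`Σ_{ω ∈ E_N(x)} I(ω)·max(0, I(ω) − 324)/((J(ω)+24)(J(ω)+48)) ≤ #E_{N+4}(x)`.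
[cite: MadrasSlade1993, Theorem 7.3.2 (proof), eq. (7.3.7) (p. 246); Theorem 7.3.2 (c)] -/
theorem endKesten_P2 (N : ℕ) :
    ∑ ω ∈ endFin x N, (#(hexSlots ω) : ℝ) * max 0 ((#(hexSlots ω) : ℝ) - 324) /
        (((#(hexSharp ω) : ℝ) + 24) * ((#(hexSharp ω) : ℝ) + 48)) ≤ (#(endFin x (N + 4)) : ℝ) := by
  classical
  refine le_trans ?_ (sum_card_hexSlots_div_le_card_endFin x N)
  set g : List HV → ℝ := fun ω' =>
    (#(hexSlots ω') : ℝ) / (((#(hexSharp ω') : ℝ) + 24) * (#(hexSharp ω') : ℝ)) with hg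
  have hB : ∑ ω' ∈ endFin x (N + 2), (#(hexSharp ω') : ℝ) * g ω' ≤
      ∑ ω' ∈ endFin x (N + 2), (#(hexSlots ω') : ℝ) / ((#(hexSharp ω') : ℝ) + 24) := by
    refine sum_le_sum fun ω' _ => ?_
    by_cases h : #(hexSharp ω') = 0
    · rw [h]; simp only [Nat.cast_zero, zero_mul, zero_add]; positivity
    · have hpos : (0 : ℝ) < #(hexSharp ω') := by exact_mod_cast Nat.pos_of_ne_zero h
      rw [hg]
      rw [show (#(hexSharp ω') : ℝ) * ((#(hexSlots ω') : ℝ) /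
          (((#(hexSharp ω') : ℝ) + 24) * (#(hexSharp ω') : ℝ))) =
          (#(hexSlots ω') : ℝ) / ((#(hexSharp ω') : ℝ) + 24) by field_simp]
  refine le_trans ?_ hB
  rw [← sum_endSharpPairs x (N + 2) g]
  rw [← sum_endSlotPairs_eq_sum_endSharpPairs x N (fun p => g (hexIns p.2.1 p.2.2.1 p.2.2.2.1 p.2.2.2.2 p.1))
    (fun q => g q.1) fun p _ => rfl]
  rw [show ∑ ω ∈ endFin x N, (#(hexSlots ω) : ℝ) * max 0 ((#(hexSlots ω) : ℝ) - 324) /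
      (((#(hexSharp ω) : ℝ) + 24) * ((#(hexSharp ω) : ℝ) + 48)) =
      ∑ ω ∈ endFin x N, (#(hexSlots ω) : ℝ) * (max 0 ((#(hexSlots ω) : ℝ) - 324) /
      (((#(hexSharp ω) : ℝ) + 24) * ((#(hexSharp ω) : ℝ) + 48))) from
    sum_congr rfl fun ω _ => by rw [mul_div_assoc]]
  rw [← sum_endSlotPairs x N (fun ω => max 0 ((#(hexSlots ω) : ℝ) - 324) /
      (((#(hexSharp ω) : ℝ) + 24) * ((#(hexSharp ω) : ℝ) + 48)))]
  refine sum_le_sum fun p hp => ?_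
  rw [endSlotPairs, Finset.mem_sigma] at hp
  obtain ⟨hω, hs⟩ := hp
  have hω' := endFin_subset x N hω
  have hs' : (p.2.1, p.2.2.1, p.2.2.2.1, p.2.2.2.2) ∈ hexSlots p.1 := hs
  set ω' := hexIns p.2.1 p.2.2.1 p.2.2.2.1 p.2.2.2.2 p.1 with hω'def
  have hJ1 : (1 : ℝ) ≤ #(hexSharp ω') := by exact_mod_cast one_le_card_hexSharp_hexIns hω' hs'
  have hJ3 : (#(hexSharp ω') : ℝ) ≤ #(hexSharp p.1) + 24 := by
    exact_mod_cast card_hexSharp_hexIns_le hω' hs'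
  have hI : (#(hexSlots p.1) : ℝ) ≤ #(hexSlots ω') + 324 := by
    exact_mod_cast card_hexSlots_le_hexIns hω' hs'
  have hJ0 : (0 : ℝ) ≤ #(hexSharp p.1) := Nat.cast_nonneg _
  have hI0 : (0 : ℝ) ≤ #(hexSlots ω') := Nat.cast_nonneg _
  show max 0 ((#(hexSlots p.1) : ℝ) - 324) / (((#(hexSharp p.1) : ℝ) + 24) * ((#(hexSharp p.1) : ℝ) + 48)) ≤ g ω'
  rw [hg]; simp only
  have hden : ((#(hexSharp ω') : ℝ) + 24) * (#(hexSharp ω') : ℝ) ≤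
      ((#(hexSharp p.1) : ℝ) + 24) * ((#(hexSharp p.1) : ℝ) + 48) := by nlinarith
  have hden0 : 0 < ((#(hexSharp ω') : ℝ) + 24) * (#(hexSharp ω') : ℝ) := by positivity
  rcases le_or_gt ((#(hexSlots p.1) : ℝ) - 324) 0 with hneg | hpos
  · rw [max_eq_left hneg, zero_div]
    exact div_nonneg hI0 hden0.le
  · rw [max_eq_right hpos.le]
    calc ((#(hexSlots p.1) : ℝ) - 324) / (((#(hexSharp p.1) : ℝ) + 24) * ((#(hexSharp p.1) : ℝ) + 48))
        ≤ ((#(hexSlots p.1) : ℝ) - 324) / (((#(hexSharp ω') : ℝ) + 24) * (#(hexSharp ω') : ℝ)) :=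
          div_le_div_of_nonneg_left hpos.le hden0 hden
      _ ≤ (#(hexSlots ω') : ℝ) / (((#(hexSharp ω') : ℝ) + 24) * (#(hexSharp ω') : ℝ)) :=
          div_le_div_of_nonneg_right (by linarith) hden0.le

end TransferP2E

end Literature.Probability.RandomPlanarGeometry.SAW.HV

end
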